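import Mathlib
import Summits.AtomisticToContinuum.HydrodynamicLimit.Theorems.ImplosionDichotomyDenseExcursionSonicConfinementCharacteristic
import Summits.AtomisticToContinuum.HydrodynamicLimit.Theorems.ImplosionDichotomyDenseExcursionSonicConfinementFlat
import Summits.AtomisticToContinuum.HydrodynamicLimit.Theorems.ImplosionDichotomyDenseExcursionSonicRealBoundUnique

/-!
# Unique continuation of smooth radial modes through the sonic point
# (crux `DenseExcursion`, line `sonic-cavity-renewal`, brick for stub `stub_sonicConfinement`)

Helper file (`--supports stmt-AtomisticToContinuum-12586`, line lead a2, stub-worker for `stub_sonicConfinement`).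

`sonic_unique_continuation` (registered helper): for a monatomic profile in the cavity tube, a smooth radial mode
`(Λ, ŵ, ŝ)` that vanishes at ONE point `x₀ < 0` of the core vanishes identically on `ℝ` (hence contradicts the
non-triviality clause of `IsSmoothRadialMode`). This is the uniqueness half of every Evans-function / matching argument of
the line (the `|Im Λ|`-confinement `stub_sonicConfinement` concludes `v(x_m) = 0` at a matching point `x_m < 0`; the
`CavityResolvent` uniqueness clause is the inhomogeneous analogue):

1. on the core `x < 0` the characteristic speeds `c₊ = W + S − 1 > 0` (tube (a)) and `c₋ = W − 1 − S ≤ −3/4` (tube (c): `|W| ≤ 1/4`)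
   do not vanish, so the characteristic system (`mode_char_system`) is a linear ODE with continuous coefficients and Grönwall
   gives `v ≡ 0` on `x < 0` (`mode_eq_zero_on_neg`, both time directions);
2. by smoothness all derivatives of `ŵ, ŝ` vanish at `0` (`iteratedDeriv_eq_zero_of_eqOn_neg`), so `‖v x‖ ≤ M x^N` on `[0, 1]` for
   every `N` (`norm_le_pow_of_iteratedDeriv_eq_zero`);
3. on `0 < x ≤ 1` the sonic point is a regular singular point: `|c₊| ≥ 3x/8` (chord bound, tube (a)), `|c₋| ≥ 3/4`, whence
   `‖v′‖ ≤ (C/x)‖v‖`; the singular Grönwall lemma `eq_zero_of_flat_of_norm_deriv_le` with `N ≥ C + 1` gives `v ≡ 0` on `(0, 1]`;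
4. `realBound_unique_right` (`…SonicRealBoundUnique`) continues `v ≡ 0` from `x < 1` to all of `ℝ`.

NOT here: the stub (see the worker report: the two missing analytic inputs `SonicSlaving`, `CentreContent`).
-/

noncomputable section

open Set Filter
open scoped Topology ContDiff

namespace Summit.AtomisticToContinuum.HydrodynamicLimit.Theorems.SonicCavityRenewal

open Summit.AtomisticToContinuum.HydrodynamicLimit.Theorems.R2OneModeTwoConditions

/-! ## Grönwall uniqueness, leftward -/

/-- Grönwall uniqueness BACKWARDS in time: if `‖v′‖ ≤ K ‖v‖` on `(a, b]` and `v b = 0` then `v ≡ 0` on `[a, b]` (reflect `t ↦ −t` in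
`eq_zero_of_abs_deriv_le_mul_abs_self_of_eq_zero_right`). [folklore] -/
theorem eq_zero_of_norm_deriv_le_left {v v' : ℝ → ℂ × ℂ} {K a b : ℝ} (hcont : ContinuousOn v (Icc a b))
    (hv : ∀ x ∈ Ioc a b, HasDerivAt v (v' x) x) (hbound : ∀ x ∈ Ioc a b, ‖v' x‖ ≤ K * ‖v x‖) (hb : v b = 0) :
    ∀ x ∈ Icc a b, v x = 0 := by
  intro x hx
  have hmaps : MapsTo Neg.neg (Icc (-b) (-a)) (Icc a b) := fun t ht => ⟨by linarith [ht.2], by linarith [ht.1]⟩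
  have key := eq_zero_of_abs_deriv_le_mul_abs_self_of_eq_zero_right (f := fun t => v (-t))
    (f' := fun t => (-1 : ℝ) • v' (-t)) (K := K) (a := -b) (b := -a) (hcont.comp continuousOn_neg hmaps)
    ?_ (by simp [hb]) ?_ (-x) ⟨by linarith [hx.2], by linarith [hx.1]⟩
  · simpa using key
  · intro t ht
    have ht' : -t ∈ Ioc a b := ⟨by linarith [ht.2], by linarith [ht.1]⟩
    exact ((hv (-t) ht').scomp t (hasDerivAt_neg t)).hasDerivWithinAt
  · intro t ht
    have ht' : -t ∈ Ioc a b := ⟨by linarith [ht.2], by linarith [ht.1]⟩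
    rw [norm_smul, norm_neg, norm_one, one_mul]
    exact hbound (-t) ht'

/-! ## The characteristic system as a linear ODE with a norm bound -/

/-- NORM FORM OF THE CHARACTERISTIC SYSTEM: where `c₊ c₋ ≠ 0`, the derivative of `v = (ŵ + 3ŝ, ŵ − 3ŝ)` is bounded by
`(‖Λ‖ + |b₊₊| + |b₊₋| + |b₋₊| + |b₋₋|)(|c₊|⁻¹ + |c₋|⁻¹)·‖v‖` (sup norm on `ℂ × ℂ`). [folklore] -/
theorem char_deriv_norm_le {r : ℝ} {W S : ℝ → ℝ} {Λ : ℂ} {ŵ ŝ : ℝ → ℂ} {x : ℝ}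
    (h : Λ * ŵ x = linW r W S ŵ ŝ x ∧ Λ * ŝ x = linS r W S ŵ ŝ x) (hp : W x - 1 + S x ≠ 0) (hm : W x - 1 - S x ≠ 0) :
    ‖(deriv ŵ x + 3 * deriv ŝ x, deriv ŵ x - 3 * deriv ŝ x)‖ ≤
      (‖Λ‖ + |2 / 3 * deriv W x + 2 * W x - r + 2 * deriv S x + 4 * S x| + |deriv W x / 3 + deriv S x + 2 * S x| +
            |deriv W x / 3 - deriv S x - 2 * S x| + |2 / 3 * deriv W x + 2 * W x - r - 2 * deriv S x - 4 * S x|) *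
          (|W x - 1 + S x|⁻¹ + |W x - 1 - S x|⁻¹) *
        ‖(ŵ x + 3 * ŝ x, ŵ x - 3 * ŝ x)‖ := by
  obtain ⟨c1, c2⟩ := mode_char_system h
  set p : ℂ := ŵ x + 3 * ŝ x with hpdef
  set m : ℂ := ŵ x - 3 * ŝ x with hmdef
  set p' : ℂ := deriv ŵ x + 3 * deriv ŝ x with hp'def
  set m' : ℂ := deriv ŵ x - 3 * deriv ŝ x with hm'def
  set bpp : ℝ := 2 / 3 * deriv W x + 2 * W x - r + 2 * deriv S x + 4 * S x with hbpp
  set bpm : ℝ := deriv W x / 3 + deriv S x + 2 * S x with hbpm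
  set bmp : ℝ := deriv W x / 3 - deriv S x - 2 * S x with hbmp
  set bmm : ℝ := 2 / 3 * deriv W x + 2 * W x - r - 2 * deriv S x - 4 * S x with hbmm
  set cp : ℝ := W x - 1 + S x with hcp
  set cm : ℝ := W x - 1 - S x with hcm
  set n : ℝ := ‖(p, m)‖ with hn
  have hpn : ‖p‖ ≤ n := norm_fst_le (p, m)
  have hmn : ‖m‖ ≤ n := norm_snd_le (p, m)
  have hn0 : 0 ≤ n := norm_nonneg _
  have hcp' : (cp : ℂ) ≠ 0 := Complex.ofReal_ne_zero.2 hp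
  have hcm' : (cm : ℂ) ≠ 0 := Complex.ofReal_ne_zero.2 hm
  set Bs : ℝ := ‖Λ‖ + |bpp| + |bpm| + |bmp| + |bmm| with hBs
  have hB1 : ‖Λ‖ + |bpp| + |bpm| ≤ Bs := by
    have := abs_nonneg bmp; have := abs_nonneg bmm; linarith
  have hB2 : ‖Λ‖ + |bmm| + |bmp| ≤ Bs := by
    have := abs_nonneg bpp; have := abs_nonneg bpm; linarith
  have hBs0 : 0 ≤ Bs := le_trans (by positivity) hB1
  -- the `p`-row
  have e1 : p' = ((Λ - (bpp : ℂ)) * p - (bpm : ℂ) * m) / (cp : ℂ) := by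
    rw [eq_div_iff hcp']
    linear_combination c1
  have hp1 : ‖p'‖ ≤ Bs * |cp|⁻¹ * n := by
    rw [e1, norm_div, Complex.norm_real, Real.norm_eq_abs, div_eq_mul_inv]
    have hnum : ‖(Λ - (bpp : ℂ)) * p - (bpm : ℂ) * m‖ ≤ Bs * n := by
      calc ‖(Λ - (bpp : ℂ)) * p - (bpm : ℂ) * m‖ ≤ ‖(Λ - (bpp : ℂ)) * p‖ + ‖(bpm : ℂ) * m‖ := norm_sub_le _ _
        _ ≤ (‖Λ‖ + |bpp|) * n + |bpm| * n := by
            rw [norm_mul, norm_mul, Complex.norm_real, Real.norm_eq_abs]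
            have hc : ‖Λ - (bpp : ℂ)‖ ≤ ‖Λ‖ + |bpp| :=
              calc ‖Λ - (bpp : ℂ)‖ ≤ ‖Λ‖ + ‖(bpp : ℂ)‖ := norm_sub_le _ _
                _ = ‖Λ‖ + |bpp| := by rw [Complex.norm_real, Real.norm_eq_abs]
            exact add_le_add (mul_le_mul hc hpn (norm_nonneg _) (by positivity))
              (mul_le_mul_of_nonneg_left hmn (abs_nonneg _))
        _ = (‖Λ‖ + |bpp| + |bpm|) * n := by ring
        _ ≤ Bs * n := mul_le_mul_of_nonneg_right hB1 hn0
    calc ‖(Λ - (bpp : ℂ)) * p - (bpm : ℂ) * m‖ * |cp|⁻¹ ≤ Bs * n * |cp|⁻¹ :=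
          mul_le_mul_of_nonneg_right hnum (inv_nonneg.2 (abs_nonneg _))
      _ = Bs * |cp|⁻¹ * n := by ring
  -- the `m`-row
  have e2 : m' = (-(bmp : ℂ) * p + (Λ - (bmm : ℂ)) * m) / (cm : ℂ) := by
    rw [eq_div_iff hcm']
    linear_combination c2
  have hm1 : ‖m'‖ ≤ Bs * |cm|⁻¹ * n := by
    rw [e2, norm_div, Complex.norm_real, Real.norm_eq_abs, div_eq_mul_inv]
    have hnum : ‖-(bmp : ℂ) * p + (Λ - (bmm : ℂ)) * m‖ ≤ Bs * n := by
      calc ‖-(bmp : ℂ) * p + (Λ - (bmm : ℂ)) * m‖ ≤ ‖-(bmp : ℂ) * p‖ + ‖(Λ - (bmm : ℂ)) * m‖ := norm_add_le _ _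
        _ ≤ |bmp| * n + (‖Λ‖ + |bmm|) * n := by
            rw [norm_mul, norm_mul, norm_neg, Complex.norm_real, Real.norm_eq_abs]
            have hc : ‖Λ - (bmm : ℂ)‖ ≤ ‖Λ‖ + |bmm| :=
              calc ‖Λ - (bmm : ℂ)‖ ≤ ‖Λ‖ + ‖(bmm : ℂ)‖ := norm_sub_le _ _
                _ = ‖Λ‖ + |bmm| := by rw [Complex.norm_real, Real.norm_eq_abs]
            exact add_le_add (mul_le_mul_of_nonneg_left hpn (abs_nonneg _))
              (mul_le_mul hc hmn (norm_nonneg _) (by positivity))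
        _ = (‖Λ‖ + |bmm| + |bmp|) * n := by ring
        _ ≤ Bs * n := mul_le_mul_of_nonneg_right hB2 hn0
    calc ‖-(bmp : ℂ) * p + (Λ - (bmm : ℂ)) * m‖ * |cm|⁻¹ ≤ Bs * n * |cm|⁻¹ :=
          mul_le_mul_of_nonneg_right hnum (inv_nonneg.2 (abs_nonneg _))
      _ = Bs * |cm|⁻¹ * n := by ring
  -- assemble (sup norm)
  have hi1 : 0 ≤ |cp|⁻¹ := inv_nonneg.2 (abs_nonneg _)
  have hi2 : 0 ≤ |cm|⁻¹ := inv_nonneg.2 (abs_nonneg _)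
  rw [Prod.norm_mk, max_le_iff]
  constructor
  · calc ‖p'‖ ≤ Bs * |cp|⁻¹ * n := hp1
      _ ≤ Bs * (|cp|⁻¹ + |cm|⁻¹) * n := by gcongr; linarith
  · calc ‖m'‖ ≤ Bs * |cm|⁻¹ * n := hm1
      _ ≤ Bs * (|cp|⁻¹ + |cm|⁻¹) * n := by gcongr; linarith

/-- The order-0 coefficient sum `‖Λ‖ + Σ|b|` of `char_deriv_norm_le` is a continuous function of `x` for `C^∞` profiles
(packaged as an existential `K` with its defining identity, to keep this proof file free of definitions). [folklore] -/
theorem charCoeffSum_continuous (r : ℝ) {W S : ℝ → ℝ} (hW : ContDiff ℝ ∞ W) (hS : ContDiff ℝ ∞ S) (Λ : ℂ) :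
    ∃ K : ℝ → ℝ, Continuous K ∧ ∀ x, K x =
      ‖Λ‖ + |2 / 3 * deriv W x + 2 * W x - r + 2 * deriv S x + 4 * S x| + |deriv W x / 3 + deriv S x + 2 * S x| +
        |deriv W x / 3 - deriv S x - 2 * S x| + |2 / 3 * deriv W x + 2 * W x - r - 2 * deriv S x - 4 * S x| := by
  have hW0 : Continuous W := hW.continuous
  have hS0 : Continuous S := hS.continuous
  have hW1 : Continuous (deriv W) := hW.continuous_deriv (by simp)
  have hS1 : Continuous (deriv S) := hS.continuous_deriv (by simp)
  refine ⟨fun x => ‖Λ‖ + |2 / 3 * deriv W x + 2 * W x - r + 2 * deriv S x + 4 * S x| +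
    |deriv W x / 3 + deriv S x + 2 * S x| + |deriv W x / 3 - deriv S x - 2 * S x| +
    |2 / 3 * deriv W x + 2 * W x - r - 2 * deriv S x - 4 * S x|, by fun_prop, fun x => rfl⟩

/-! ## Step 1: vanishing on the core `x < 0` -/

/-- A smooth radial mode of a tube profile that vanishes at some `x₀ < 0` vanishes on the whole core `x < 0`: Grönwall for the
characteristic system, whose growth coefficient is continuous on compact subintervals of `(−∞, 0)` because
`c₊ = W + S − 1 > 0` (tube (a)) and `c₋ = W − 1 − S ≤ −3/4` (tube (c), `S > 0`) there. [folklore] -/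
theorem mode_eq_zero_on_neg {r : ℝ} {W S : ℝ → ℝ} {Λ : ℂ} {ŵ ŝ : ℝ → ℂ} (hP : IsMonatomicProfile r W S)
    (hT : CavityTube r W S) (hmode : IsSmoothRadialMode r W S Λ ŵ ŝ) {x₀ : ℝ} (hx₀ : x₀ < 0) (hw0 : ŵ x₀ = 0)
    (hs0 : ŝ x₀ = 0) : ∀ x, x < 0 → ŵ x = 0 ∧ ŝ x = 0 := by
  intro x hx
  obtain ⟨-, -, hW, hS, hSpos, -⟩ := hP
  obtain ⟨-, hsup, -, -, -, -, -, hcW, -⟩ := hT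
  obtain ⟨⟨hŵ, hŝ, -⟩, -, heq⟩ := hmode
  have hŵ1 : Differentiable ℝ ŵ := hŵ.differentiable (by simp)
  have hŝ1 : Differentiable ℝ ŝ := hŝ.differentiable (by simp)
  have hW0 : Continuous W := hW.continuous
  have hS0 : Continuous S := hS.continuous
  obtain ⟨K, hKc, hKx⟩ := charCoeffSum_continuous r hW hS Λ
  -- non-vanishing of the speeds on `y < 0`
  have hcp : ∀ y, y < 0 → 0 < W y - 1 + S y := fun y hy => by linarith [hsup y hy]
  have hcm : ∀ y, y ≤ 1 → W y - 1 - S y < 0 := fun y hy => by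
    have h1 := (abs_le.1 (hcW y hy).1).2
    have h2 := hSpos y
    linarith
  -- the vector `v = (p, m)` and its derivative
  set v : ℝ → ℂ × ℂ := fun y => (ŵ y + 3 * ŝ y, ŵ y - 3 * ŝ y) with hv
  set v' : ℝ → ℂ × ℂ := fun y => (deriv ŵ y + 3 * deriv ŝ y, deriv ŵ y - 3 * deriv ŝ y) with hv'
  have hvd : ∀ y, HasDerivAt v (v' y) y := fun y =>
    (hasDerivAt_char_components (hŵ1 y) (hŝ1 y)).1.prodMk (hasDerivAt_char_components (hŵ1 y) (hŝ1 y)).2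
  have hvc : Continuous v := continuous_iff_continuousAt.2 fun y => (hvd y).continuousAt
  have hv0 : v x₀ = 0 := by
    simp only [hv, hw0, hs0, mul_zero, add_zero, sub_zero]
    rfl
  -- a uniform growth bound on `[lo, hi] ⊂ (−∞, 0)`
  set lo := min x x₀ with hlo
  set hi := max x x₀ with hhi
  have hhi0 : hi < 0 := max_lt hx hx₀
  have hinvp : ContinuousOn (fun y => |W y - 1 + S y|⁻¹) (Icc lo hi) := by
    refine ContinuousOn.inv₀ (by fun_prop) fun y hy => ?_
    exact abs_ne_zero.2 (hcp y (lt_of_le_of_lt hy.2 hhi0)).ne'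
  have hinvm : ContinuousOn (fun y => |W y - 1 - S y|⁻¹) (Icc lo hi) := by
    refine ContinuousOn.inv₀ (by fun_prop) fun y hy => ?_
    exact abs_ne_zero.2 (hcm y (by linarith [hy.2, hhi0])).ne
  have hGc : ContinuousOn (fun y => K y * (|W y - 1 + S y|⁻¹ + |W y - 1 - S y|⁻¹)) (Icc lo hi) :=
    hKc.continuousOn.mul (hinvp.add hinvm)
  obtain ⟨K', hK'⟩ := isCompact_Icc.exists_bound_of_continuousOn hGc
  have hbound : ∀ y ∈ Icc lo hi, ‖v' y‖ ≤ K' * ‖v y‖ := by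
    intro y hy
    have hy0 : y < 0 := lt_of_le_of_lt hy.2 hhi0
    have h := char_deriv_norm_le (heq y) (hcp y hy0).ne' (hcm y (by linarith)).ne
    rw [← hKx y] at h
    refine h.trans (mul_le_mul_of_nonneg_right ?_ (norm_nonneg _))
    have hKy := hK' y hy
    rw [Real.norm_eq_abs] at hKy
    exact (le_abs_self _).trans hKy
  -- Grönwall in the appropriate direction
  have hvx : v x = 0 := by
    rcases le_total x x₀ with hle | hle
    · have hlo' : lo = x := min_eq_left hle
      have hhi' : hi = x₀ := max_eq_right hle
      refine eq_zero_of_norm_deriv_le_left (a := x) (b := x₀) hvc.continuousOn (fun y _ => hvd y)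
        (fun y hy => hbound y ?_) hv0 x ⟨le_rfl, hle⟩
      rw [hlo', hhi']
      exact Ioc_subset_Icc_self hy
    · have hlo' : lo = x₀ := min_eq_right hle
      have hhi' : hi = x := max_eq_left hle
      refine eq_zero_of_abs_deriv_le_mul_abs_self_of_eq_zero_right (a := x₀) (b := x) hvc.continuousOn
        (fun y _ => (hvd y).hasDerivWithinAt) hv0 (fun y hy => hbound y ?_) x ⟨hle, le_rfl⟩
      rw [hlo', hhi']
      exact Ico_subset_Icc_self hy
  have h1 : ŵ x + 3 * ŝ x = 0 := by simpa [hv] using congrArg Prod.fst hvx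
  have h2 : ŵ x - 3 * ŝ x = 0 := by simpa [hv] using congrArg Prod.snd hvx
  constructor
  · linear_combination (h1 + h2) / 2
  · linear_combination (h1 - h2) / 6

/-! ## Steps 2–3: flatness at the sonic point and the singular Grönwall lemma on `(0, 1]` -/

/-- A smooth radial mode of a tube profile that vanishes on the core `x < 0` vanishes on `(0, 1]`: all derivatives of `ŵ, ŝ`
vanish at `0`, so `‖v x‖ ≤ M x^N` for every `N`; on `(0, 1]` the chord bound `|W + S − 1| ≥ 3x/8` and `|W − 1 − S| ≥ 3/4` give
`‖v′‖ ≤ (C/x)‖v‖`, and `eq_zero_of_flat_of_norm_deriv_le` applies with `N = ⌈C⌉ + 1`. [folklore] -/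
theorem mode_eq_zero_Ioc_of_eqOn_neg {r : ℝ} {W S : ℝ → ℝ} {Λ : ℂ} {ŵ ŝ : ℝ → ℂ} (hP : IsMonatomicProfile r W S)
    (hT : CavityTube r W S) (hmode : IsSmoothRadialMode r W S Λ ŵ ŝ) (hneg : ∀ x, x < 0 → ŵ x = 0 ∧ ŝ x = 0) :
    ∀ x ∈ Ioc (0 : ℝ) 1, ŵ x = 0 ∧ ŝ x = 0 := by
  obtain ⟨-, -, hW, hS, hSpos, -⟩ := hP
  obtain ⟨-, -, hsub, hchord, -, -, -, hcW, -⟩ := hT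
  obtain ⟨⟨hŵ, hŝ, -⟩, -, heq⟩ := hmode
  have hŵ1 : Differentiable ℝ ŵ := hŵ.differentiable (by simp)
  have hŝ1 : Differentiable ℝ ŝ := hŝ.differentiable (by simp)
  obtain ⟨K, hKc, hKx⟩ := charCoeffSum_continuous r hW hS Λ
  -- speeds on `(0, 1]`
  have hcp : ∀ y ∈ Ioc (0 : ℝ) 1, 3 / 8 * y ≤ |W y - 1 + S y| := by
    intro y hy
    have h := hchord y hy.2
    rwa [abs_of_pos hy.1, min_eq_left hy.2, show W y + S y - 1 = W y - 1 + S y by ring] at h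
  have hcm : ∀ y ∈ Ioc (0 : ℝ) 1, 3 / 4 ≤ |W y - 1 - S y| := by
    intro y hy
    have h1 := (abs_le.1 (hcW y hy.2).1).2
    have h2 := hSpos y
    rw [abs_of_neg (by linarith)]
    linarith
  -- the vector `v = (p, m)`
  set v : ℝ → ℂ × ℂ := fun y => (ŵ y + 3 * ŝ y, ŵ y - 3 * ŝ y) with hv
  set v' : ℝ → ℂ × ℂ := fun y => (deriv ŵ y + 3 * deriv ŝ y, deriv ŵ y - 3 * deriv ŝ y) with hv'
  have hvd : ∀ y, HasDerivAt v (v' y) y := fun y =>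
    (hasDerivAt_char_components (hŵ1 y) (hŝ1 y)).1.prodMk (hasDerivAt_char_components (hŵ1 y) (hŝ1 y)).2
  -- the singular growth bound `‖v′‖ ≤ (C/y) ‖v‖` on `(0, 1]`
  obtain ⟨B₀, hB₀⟩ := isCompact_Icc.exists_bound_of_continuousOn (hKc.continuousOn (s := Icc (0 : ℝ) 1))
  have hB₀0 : 0 ≤ B₀ := le_trans (norm_nonneg _) (hB₀ 0 (left_mem_Icc.2 zero_le_one))
  set C : ℝ := 4 * B₀ with hC
  have hbound : ∀ y ∈ Ioc (0 : ℝ) 1, ‖v' y‖ ≤ C / y * ‖v y‖ := by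
    intro y hy
    have hy0 : 0 < y := hy.1
    have hp0 : W y - 1 + S y ≠ 0 := abs_pos.1 (lt_of_lt_of_le (by positivity) (hcp y hy))
    have hm0 : W y - 1 - S y ≠ 0 := abs_pos.1 (lt_of_lt_of_le (by norm_num) (hcm y hy))
    have h := char_deriv_norm_le (heq y) hp0 hm0
    rw [← hKx y] at h
    refine h.trans (mul_le_mul_of_nonneg_right ?_ (norm_nonneg _))
    have hKy : K y ≤ B₀ := by
      have h' := hB₀ y ⟨hy0.le, hy.2⟩
      rw [Real.norm_eq_abs] at h'
      exact (le_abs_self _).trans h'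
    have hi1 : |W y - 1 + S y|⁻¹ ≤ 8 / 3 / y := by
      rw [inv_le_comm₀ (abs_pos.2 hp0) (by positivity), inv_div]
      linarith [hcp y hy]
    have hi2 : |W y - 1 - S y|⁻¹ ≤ 4 / 3 / y := by
      rw [inv_le_comm₀ (abs_pos.2 hm0) (by positivity), inv_div]
      have : y / (4 / 3) ≤ 3 / 4 := by rw [div_le_iff₀ (by norm_num)]; linarith [hy.2]
      linarith [hcm y hy]
    calc K y * (|W y - 1 + S y|⁻¹ + |W y - 1 - S y|⁻¹) ≤ B₀ * (8 / 3 / y + 4 / 3 / y) :=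
          mul_le_mul hKy (add_le_add hi1 hi2) (by positivity) hB₀0
      _ = C / y := by rw [hC]; field_simp; ring
  -- flatness at `0`
  set N : ℕ := ⌈C⌉₊ + 1 with hN
  have hflatw := norm_le_pow_of_iteratedDeriv_eq_zero (n := ⌈C⌉₊) zero_lt_one hŵ
    (fun k _ => iteratedDeriv_eq_zero_of_eqOn_neg hŵ (fun x hx => (hneg x hx).1) k)
  have hflats := norm_le_pow_of_iteratedDeriv_eq_zero (n := ⌈C⌉₊) zero_lt_one hŝ
    (fun k _ => iteratedDeriv_eq_zero_of_eqOn_neg hŝ (fun x hx => (hneg x hx).2) k)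
  obtain ⟨M₁, hM₁⟩ := hflatw
  obtain ⟨M₂, hM₂⟩ := hflats
  have hflat : ∀ y ∈ Ioc (0 : ℝ) 1, ‖v y‖ ≤ (|M₁| + 3 * |M₂|) * y ^ N := by
    intro y hy
    have hy' : y ∈ Icc (0 : ℝ) 1 := ⟨hy.1.le, hy.2⟩
    have hyN : 0 ≤ y ^ N := pow_nonneg hy.1.le N
    have h1 : ‖ŵ y‖ ≤ |M₁| * y ^ N := (hM₁ y hy').trans (mul_le_mul_of_nonneg_right (le_abs_self _) hyN)
    have h2 : ‖ŝ y‖ ≤ |M₂| * y ^ N := (hM₂ y hy').trans (mul_le_mul_of_nonneg_right (le_abs_self _) hyN)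
    have h3 : ‖(3 : ℂ) * ŝ y‖ = 3 * ‖ŝ y‖ := by
      rw [norm_mul]
      norm_num
    change ‖(ŵ y + 3 * ŝ y, ŵ y - 3 * ŝ y)‖ ≤ _
    rw [Prod.norm_mk, max_le_iff]
    constructor
    · calc ‖ŵ y + 3 * ŝ y‖ ≤ ‖ŵ y‖ + ‖(3 : ℂ) * ŝ y‖ := norm_add_le _ _
        _ ≤ |M₁| * y ^ N + 3 * (|M₂| * y ^ N) := by rw [h3]; gcongr
        _ = (|M₁| + 3 * |M₂|) * y ^ N := by ring
    · calc ‖ŵ y - 3 * ŝ y‖ ≤ ‖ŵ y‖ + ‖(3 : ℂ) * ŝ y‖ := norm_sub_le _ _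
        _ ≤ |M₁| * y ^ N + 3 * (|M₂| * y ^ N) := by rw [h3]; gcongr
        _ = (|M₁| + 3 * |M₂|) * y ^ N := by ring
  have hCN : C + 1 ≤ (N : ℝ) := by
    rw [hN]
    push_cast
    linarith [Nat.le_ceil C]
  have hC0 : 0 ≤ C := by rw [hC]; positivity
  have hzero := eq_zero_of_flat_of_norm_deriv_le v v' 1 C (|M₁| + 3 * |M₂|) N zero_lt_one le_rfl hC0
    (fun y _ => hvd y) hbound hflat hCN
  intro x hx
  have hvx := hzero x hx
  have h1 : ŵ x + 3 * ŝ x = 0 := by simpa [hv] using congrArg Prod.fst hvx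
  have h2 : ŵ x - 3 * ŝ x = 0 := by simpa [hv] using congrArg Prod.snd hvx
  constructor
  · linear_combination (h1 + h2) / 2
  · linear_combination (h1 - h2) / 6

/-! ## The continuation theorem -/

/-- **UNIQUE CONTINUATION OF SMOOTH RADIAL MODES THROUGH THE SONIC POINT** — registered helper `sonic_unique_continuation`
for `stub_sonicConfinement`. For a monatomic profile in the cavity tube, a smooth radial mode vanishing at one point `x₀ < 0`
vanishes identically: core (`mode_eq_zero_on_neg`), sonic point (flatness + singular Grönwall, `mode_eq_zero_Ioc_of_eqOn_neg`),
exterior (`realBound_unique_right`). In particular (`IsSmoothRadialMode` is non-trivial) a smooth radial mode never vanishes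
on the core. [folklore] -/
theorem sonic_unique_continuation : ∀ (r : ℝ) (W S : ℝ → ℝ) (Λ : ℂ) (ŵ ŝ : ℝ → ℂ), IsMonatomicProfile r W S → CavityTube r W S → IsSmoothRadialMode r W S Λ ŵ ŝ → ∀ x₀ : ℝ, x₀ < 0 → ŵ x₀ = 0 → ŝ x₀ = 0 → ∀ x, ŵ x = 0 ∧ ŝ x = 0 := by
  intro r W S Λ ŵ ŝ hP hT hmode x₀ hx₀ hw0 hs0
  have hneg : ∀ x, x < 0 → ŵ x = 0 ∧ ŝ x = 0 := mode_eq_zero_on_neg hP hT hmode hx₀ hw0 hs0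
  have hpos : ∀ x ∈ Ioc (0 : ℝ) 1, ŵ x = 0 ∧ ŝ x = 0 := mode_eq_zero_Ioc_of_eqOn_neg hP hT hmode hneg
  obtain ⟨⟨hŵ, hŝ, -⟩, -, -⟩ := id hmode
  have h0 : ŵ 0 = 0 ∧ ŝ 0 = 0 := by
    have h1 := iteratedDeriv_eq_zero_of_eqOn_neg hŵ (fun x hx => (hneg x hx).1) 0
    have h2 := iteratedDeriv_eq_zero_of_eqOn_neg hŝ (fun x hx => (hneg x hx).2) 0
    rw [iteratedDeriv_zero] at h1 h2
    exact ⟨h1, h2⟩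
  refine realBound_unique_right r W S Λ ŵ ŝ hP hT hmode fun x hx => ?_
  rcases lt_trichotomy x 0 with h | h | h
  · exact hneg x h
  · rw [h]; exact h0
  · exact hpos x ⟨h, hx.le⟩

/-- Corollary: a smooth radial mode of a tube profile does not vanish at any point of the core `x < 0`. [folklore] -/
theorem smoothMode_ne_zero_on_neg {r : ℝ} {W S : ℝ → ℝ} {Λ : ℂ} {ŵ ŝ : ℝ → ℂ} (hP : IsMonatomicProfile r W S)
    (hT : CavityTube r W S) (hmode : IsSmoothRadialMode r W S Λ ŵ ŝ) {x₀ : ℝ} (hx₀ : x₀ < 0) :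
    ŵ x₀ ≠ 0 ∨ ŝ x₀ ≠ 0 := by
  by_contra h
  push Not at h
  have hall := sonic_unique_continuation r W S Λ ŵ ŝ hP hT hmode x₀ hx₀ h.1 h.2
  obtain ⟨-, ⟨x, hx⟩, -⟩ := hmode
  rcases hx with hx | hx
  · exact hx (hall x).1
  · exact hx (hall x).2

end Summit.AtomisticToContinuum.HydrodynamicLimit.Theorems.SonicCavityRenewal

end
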